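import Summits.QuantumAdvantage.QuantumAdvantage.Theorems.SosSandwichHomogeneousPBAARefutation

/-!
# Route `SosSandwich`: disjoint averaging inside the top-homogeneous sandwich class, and the two-parameter
# family on which the law `maxInf = 16·Var²/T` holds with EQUALITY

Tool + calibration for the homogeneous rung of the crux `PseudoBoundedAA` (stmt-QuantumAdvantage-15237; support item
`HomogeneousPBAAT`, stmt-QuantumAdvantage-27399). DISJOINT AVERAGING: for `p` on `Fin N` put

  `avg₂ p := ½·p(x) + ½·p(x')`  on `Fin (N + N)` (two disjoint copies, blocks by `Fin.castAdd` / `Fin.natAdd`).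

It stays in `K_T` (convexity + renaming, `PseudoBounded.convexComb/rename`), keeps the mean and the Laplacian
eigen-equation of order `T` (top-homogeneity), HALVES the variance (`Var[avg₂ p] = Var[p]/2`: the two copies are
uncorrelated, `boolAvg_blockMul`) and QUARTERS every influence (`Inf[avg₂ p] = Inf[p]/4`). Hence the ratio
`maxInf/Var²` is averaging-invariant while `maxInf/Var^a` for `a < 2` is driven to `0`: averaging is the mechanism
behind the inadmissibility of variance exponents `< 2` (`SosSandwichHomogeneousPBAATExponentCorner`).

Iterating `avg₂` `j` times on the iterated address polynomial of `SosSandwichHomogeneousPBAARefutation`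
(order `T = 2^{k+1}`, `Var = 1/4`, every `Inf = 1/T`) gives top-homogeneous members of `K_T` with
`Var = 2^{-j}/4` and EVERY influence `4^{-j}/T` (`exists_averagedAddress`), i.e.

  `Infᵢ = 16 · Var² / T`  for every variable, at every `(Var, T) = (2^{-j}/4, 2^{k+1})`  (`exists_sharp_family`):

the candidate law `maxInf ≥ C·Var²/T` of the exponent corner `(a, b) = (2, 1)` is attained with equality
(constant `16`) on a two-parameter family exhausting `Var → 0` and `T → ∞` independently; any admissible `C` is
`≤ 16`. No named facts. [cite: ODonnell2014, §2.2–§2.3] [cite: EscuderoGutierrez2023, Thm. 1.6, Cor. 1.7]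
[cite: KaniewskiLeeDewolf2015, Def. 7]
-/

set_option linter.dupNamespace false -- D-0017: single-problem summit ⇒ `QuantumAdvantage.QuantumAdvantage` by design

noncomputable section
namespace Summit.QuantumAdvantage.QuantumAdvantage.Theorems.SosSandwich

open Finset MvPolynomial Literature.Computability.QuantumComplexity

namespace Avg2

variable {N : ℕ} (p : MvPolynomial (Fin N) ℝ)

/-- Pointwise value of the disjoint average: `(avg₂ p)(z) = (p(z|₁) + p(z|₂))/2`. [folklore] -/
theorem evalBool_avg (z : Fin (N + N) → Bool) :
    evalBool (C (1 / 2) * rename (Fin.castAdd N) p + C (1 / 2) * rename (Fin.natAdd N) p) z =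
      1 / 2 * evalBool p (z ∘ Fin.castAdd N) + 1 / 2 * evalBool p (z ∘ Fin.natAdd N) := by
  rw [AddrWitness.evalBool_add', AddrWitness.evalBool_C_mul', AddrWitness.evalBool_C_mul',
    evalBool_rename_castAdd, evalBool_rename_natAdd]

/-- **Disjoint averaging stays in `K_T`.** [cite: KaniewskiLeeDewolf2015, Def. 7] -/
theorem pseudoBounded_avg {T : ℕ} (h : PseudoBounded T p) :
    PseudoBounded T (C (1 / 2) * rename (Fin.castAdd N) p + C (1 / 2) * rename (Fin.natAdd N) p) := by
  have h2 := PseudoBounded.convexComb (PseudoBounded.rename (Fin.castAdd N) h)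
    (PseudoBounded.rename (Fin.natAdd N) h) (l := 1 / 2) (by norm_num) (by norm_num)
  norm_num at h2
  exact h2

/-- Disjoint averaging keeps the mean. [folklore] -/
theorem boolAvg_avg :
    boolAvg (evalBool (C (1 / 2) * rename (Fin.castAdd N) p + C (1 / 2) * rename (Fin.natAdd N) p)) =
      boolAvg (evalBool p) := by
  rw [show evalBool (C (1 / 2) * rename (Fin.castAdd N) p + C (1 / 2) * rename (Fin.natAdd N) p) =
      fun z => 1 / 2 * evalBool p (z ∘ Fin.castAdd N) + 1 / 2 * evalBool p (z ∘ Fin.natAdd N) from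
    funext (evalBool_avg p), avg_add, avg_const_mul, avg_const_mul, AddrWitness.boolAvg_comp_castAdd,
    AddrWitness.boolAvg_comp_natAdd]
  ring

/-- Flip differences of the disjoint average: a first-block flip. [folklore] -/
theorem sub_flip_castAdd (z : Fin (N + N) → Bool) (i : Fin N) :
    evalBool (C (1 / 2) * rename (Fin.castAdd N) p + C (1 / 2) * rename (Fin.natAdd N) p) z -
      evalBool (C (1 / 2) * rename (Fin.castAdd N) p + C (1 / 2) * rename (Fin.natAdd N) p)
        (flipBit (Fin.castAdd N i) z) =
      1 / 2 * (evalBool p (z ∘ Fin.castAdd N) - evalBool p (flipBit i (z ∘ Fin.castAdd N))) := by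
  rw [evalBool_avg, evalBool_avg, flipBit_castAdd_comp_castAdd, flipBit_castAdd_comp_natAdd]
  ring

/-- Flip differences of the disjoint average: a second-block flip. [folklore] -/
theorem sub_flip_natAdd (z : Fin (N + N) → Bool) (j : Fin N) :
    evalBool (C (1 / 2) * rename (Fin.castAdd N) p + C (1 / 2) * rename (Fin.natAdd N) p) z -
      evalBool (C (1 / 2) * rename (Fin.castAdd N) p + C (1 / 2) * rename (Fin.natAdd N) p)
        (flipBit (Fin.natAdd N j) z) =
      1 / 2 * (evalBool p (z ∘ Fin.natAdd N) - evalBool p (flipBit j (z ∘ Fin.natAdd N))) := by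
  rw [evalBool_avg, evalBool_avg, flipBit_natAdd_comp_castAdd, flipBit_natAdd_comp_natAdd]
  ring

/-- **Disjoint averaging keeps the Laplacian eigen-equation** (top-homogeneity of order `T`). [cite: ODonnell2014, §2.3] -/
theorem laplacian_avg {T : ℕ}
    (hH : ∀ x : Fin N → Bool, ∑ i, (evalBool p x - evalBool p (flipBit i x)) =
      4 * (T : ℝ) * (evalBool p x - boolAvg (evalBool p))) (z : Fin (N + N) → Bool) :
    ∑ k, (evalBool (C (1 / 2) * rename (Fin.castAdd N) p + C (1 / 2) * rename (Fin.natAdd N) p) z -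
        evalBool (C (1 / 2) * rename (Fin.castAdd N) p + C (1 / 2) * rename (Fin.natAdd N) p) (flipBit k z)) =
      4 * (T : ℝ) * (evalBool (C (1 / 2) * rename (Fin.castAdd N) p + C (1 / 2) * rename (Fin.natAdd N) p) z -
        boolAvg (evalBool (C (1 / 2) * rename (Fin.castAdd N) p + C (1 / 2) * rename (Fin.natAdd N) p))) := by
  rw [Fin.sum_univ_add]
  simp_rw [sub_flip_castAdd, sub_flip_natAdd]
  rw [← Finset.mul_sum, ← Finset.mul_sum, hH, hH, boolAvg_avg, evalBool_avg]
  ring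

/-- **Disjoint averaging halves the variance** (the two copies are uncorrelated). [cite: ODonnell2014, §2.2] -/
theorem boolVariance_avg :
    boolVariance (C (1 / 2) * rename (Fin.castAdd N) p + C (1 / 2) * rename (Fin.natAdd N) p) =
      boolVariance p / 2 := by
  set m := boolAvg (evalBool p) with hm
  unfold boolVariance
  rw [boolAvg_avg, ← hm]
  have hfun : (fun z : Fin (N + N) → Bool =>
      (evalBool (C (1 / 2) * rename (Fin.castAdd N) p + C (1 / 2) * rename (Fin.natAdd N) p) z - m) ^ 2) =
      fun z => (1 / 4 * (evalBool p (z ∘ Fin.castAdd N) - m) ^ 2 +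
        1 / 4 * (evalBool p (z ∘ Fin.natAdd N) - m) ^ 2) +
        1 / 2 * ((evalBool p (z ∘ Fin.castAdd N) - m) * (evalBool p (z ∘ Fin.natAdd N) - m)) := by
    funext z; rw [evalBool_avg]; ring
  rw [hfun, avg_add, avg_add, avg_const_mul, avg_const_mul, avg_const_mul,
    AddrWitness.boolAvg_comp_castAdd (fun x => (evalBool p x - m) ^ 2),
    AddrWitness.boolAvg_comp_natAdd (fun y => (evalBool p y - m) ^ 2),
    boolAvg_blockMul (fun x => evalBool p x - m) (fun y => evalBool p y - m)]
  have h0 : boolAvg (fun x : Fin N → Bool => evalBool p x - m) = 0 := by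
    rw [avg_sub, boolAvg_const, hm]; exact sub_self _
  rw [h0]
  ring

/-- **Disjoint averaging quarters the influences** (first block). [cite: ODonnell2014, §2.2] -/
theorem influence_avg_castAdd (i : Fin N) :
    influence (Fin.castAdd N i) (C (1 / 2) * rename (Fin.castAdd N) p + C (1 / 2) * rename (Fin.natAdd N) p) =
      influence i p / 4 := by
  unfold influence
  simp_rw [sub_flip_castAdd]
  have hfun : (fun z : Fin (N + N) → Bool =>
      (1 / 2 * (evalBool p (z ∘ Fin.castAdd N) - evalBool p (flipBit i (z ∘ Fin.castAdd N)))) ^ 2) =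
      fun z => 1 / 4 * (evalBool p (z ∘ Fin.castAdd N) - evalBool p (flipBit i (z ∘ Fin.castAdd N))) ^ 2 := by
    funext z; ring
  rw [hfun, avg_const_mul,
    AddrWitness.boolAvg_comp_castAdd (fun x => (evalBool p x - evalBool p (flipBit i x)) ^ 2)]
  ring

/-- **Disjoint averaging quarters the influences** (second block). [cite: ODonnell2014, §2.2] -/
theorem influence_avg_natAdd (j : Fin N) :
    influence (Fin.natAdd N j) (C (1 / 2) * rename (Fin.castAdd N) p + C (1 / 2) * rename (Fin.natAdd N) p) =
      influence j p / 4 := by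
  unfold influence
  simp_rw [sub_flip_natAdd]
  have hfun : (fun z : Fin (N + N) → Bool =>
      (1 / 2 * (evalBool p (z ∘ Fin.natAdd N) - evalBool p (flipBit j (z ∘ Fin.natAdd N)))) ^ 2) =
      fun z => 1 / 4 * (evalBool p (z ∘ Fin.natAdd N) - evalBool p (flipBit j (z ∘ Fin.natAdd N))) ^ 2 := by
    funext z; ring
  rw [hfun, avg_const_mul,
    AddrWitness.boolAvg_comp_natAdd (fun y => (evalBool p y - evalBool p (flipBit j y)) ^ 2)]
  ring

end Avg2

/-- **The averaged address family.** For all `k, j` there is a polynomial `P` (the `j`-fold disjoint average of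
the iterated address polynomial) which is pseudo-bounded of order `T = 2^{k+1}`, satisfies the Laplacian
eigen-equation of order `T`, has `Var[P] = 2^{-j}/4` and EVERY influence equal to `4^{-j}/T`. [folklore] -/
theorem exists_averagedAddress (k j : ℕ) : ∃ (N : ℕ) (P : MvPolynomial (Fin N) ℝ),
    PseudoBounded (2 ^ (k + 1)) P ∧
    (∀ z, ∑ i, (evalBool P z - evalBool P (flipBit i z)) =
      4 * ((2 ^ (k + 1) : ℕ) : ℝ) * (evalBool P z - boolAvg (evalBool P))) ∧
    boolVariance P = 1 / 4 / (2 : ℝ) ^ j ∧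
    (∀ i, influence i P = 1 / (2 : ℝ) ^ (k + 1) / (4 : ℝ) ^ j) := by
  induction j with
  | zero =>
    obtain ⟨N, P, h1, h2, h3, h4⟩ := AddrWitness.exists_counterexample k
    exact ⟨N, P, h1, h2, by rw [h3]; norm_num, fun i => by rw [h4 i]; norm_num⟩
  | succ j ih =>
    obtain ⟨N, P, h1, h2, h3, h4⟩ := ih
    refine ⟨N + N, C (1 / 2) * rename (Fin.castAdd N) P + C (1 / 2) * rename (Fin.natAdd N) P,
      Avg2.pseudoBounded_avg P h1, Avg2.laplacian_avg P h2, ?_, ?_⟩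
    · rw [Avg2.boolVariance_avg, h3, pow_succ]; ring
    · intro i
      induction i using Fin.addCases with
      | left i => rw [Avg2.influence_avg_castAdd, h4, pow_succ]; ring
      | right i => rw [Avg2.influence_avg_natAdd, h4, pow_succ]; ring

/-- **The law `Infᵢ = 16·Var²/T` with equality on a two-parameter family.** For all `k, j` there is a
top-homogeneous pseudo-bounded `P` of order `T = 2^{k+1}` with `Var[P] = 2^{-j}/4 > 0` all of whose influences
equal `16·Var[P]²/T`: the corner law `maxInf ≥ C·Var²/T` (exponents `(2, 1)`) can hold with `C ≤ 16` at best, and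
is then sharp simultaneously in `Var → 0` and `T → ∞`. [cite: EscuderoGutierrez2023, Thm. 1.6, Cor. 1.7] -/
theorem exists_sharp_family (k j : ℕ) : ∃ (N : ℕ) (P : MvPolynomial (Fin N) ℝ),
    PseudoBounded (2 ^ (k + 1)) P ∧
    (∀ z, ∑ i, (evalBool P z - evalBool P (flipBit i z)) =
      4 * ((2 ^ (k + 1) : ℕ) : ℝ) * (evalBool P z - boolAvg (evalBool P))) ∧
    boolVariance P = 1 / 4 / (2 : ℝ) ^ j ∧
    (∀ i, influence i P = 16 * boolVariance P ^ 2 / ((2 ^ (k + 1) : ℕ) : ℝ)) := by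
  obtain ⟨N, P, h1, h2, h3, h4⟩ := exists_averagedAddress k j
  refine ⟨N, P, h1, h2, h3, fun i => ?_⟩
  rw [h4, h3]
  push_cast
  rw [show ((4 : ℝ)) ^ j = ((2 : ℝ) ^ j) ^ 2 by rw [← pow_mul, show (4 : ℝ) = 2 ^ 2 by norm_num, ← pow_mul, mul_comm]]
  field_simp
  ring

/-- **Any constant in the corner law is at most `16`.** If `C·Var[p]²/T ≤ maxᵢ Infᵢ[p]` for every top-homogeneous
pseudo-bounded `p` of order `T ≥ 1` with `Var[p] > 0` (literal inline vocabulary of the route file), then `C ≤ 16`.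
[cite: EscuderoGutierrez2023, Thm. 1.6, Cor. 1.7] -/
theorem cornerLaw_const_le {C : ℝ}
    (h : ∀ (N T : ℕ) (p : MvPolynomial (Fin N) ℝ),
      let ev : MvPolynomial (Fin N) ℝ → (Fin N → Bool) → ℝ :=
        fun f x => MvPolynomial.eval (fun k => if x k then (1 : ℝ) else 0) f
      let avg : ((Fin N → Bool) → ℝ) → ℝ := fun g => (∑ x : Fin N → Bool, g x) / (2 : ℝ) ^ N
      1 ≤ T →
      (∃ (m : ℕ) (q r : Fin m → MvPolynomial (Fin N) ℝ),
          (∀ j, (q j).totalDegree ≤ T ∧ (r j).totalDegree ≤ T) ∧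
            ∀ x : Fin N → Bool, ev p x = ∑ j, ev (q j) x ^ 2 ∧ 1 - ev p x = ∑ j, ev (r j) x ^ 2) →
      (∀ x : Fin N → Bool, ∑ i : Fin N, (ev p x - ev p (Function.update x i (!x i))) =
          4 * (T : ℝ) * (ev p x - avg (ev p))) →
      0 < (avg fun x => (ev p x - avg (ev p)) ^ 2) →
      ∃ i : Fin N, C * (avg fun x => (ev p x - avg (ev p)) ^ 2) ^ 2 / (T : ℝ) ≤
        (avg fun x => (ev p x - ev p (Function.update x i (!x i))) ^ 2)) :
    C ≤ 16 := by
  obtain ⟨N, P, h1, h2, h3, h4⟩ := exists_sharp_family 0 0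
  have hVpos : 0 < boolVariance P := by rw [h3]; norm_num
  obtain ⟨i, hi⟩ := h N (2 ^ (0 + 1)) P Nat.one_le_two_pow h1 h2 hVpos
  change C * boolVariance P ^ 2 / (((2 ^ (0 + 1) : ℕ) : ℝ)) ≤ influence i P at hi
  rw [h4 i] at hi
  have hT : (0 : ℝ) < (((2 ^ (0 + 1) : ℕ) : ℝ)) := by positivity
  have hV2 : 0 < boolVariance P ^ 2 := by positivity
  rw [div_le_div_iff_of_pos_right hT] at hi
  nlinarith

end Summit.QuantumAdvantage.QuantumAdvantage.Theorems.SosSandwich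
end
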